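import Summits.KontsevichZagierPeriods.KontsevichZagierPeriods.Theorems.LiftingCriteriaCubeNashNormalFormTame
import Literature.NumberTheory.Transcendental.SemialgebraicMaps
import Literature.NumberTheory.Transcendental.SemialgebraicLineDeriv
import Literature.ModelTheory.ExponentialFields.SemialgebraicInterior
import Mathlib.RingTheory.Polynomial.Resultant.Basic
import Mathlib.Analysis.Analytic.Basic
import Mathlib.Analysis.Calculus.FDeriv.Analytic
import Mathlib.MeasureTheory.Measure.Lebesgue.Basic

/-!
# Crux `CubeNashNormalForm` (stmt-KontsevichZagierPeriods-3574), line `Sketch` — stub `stub_chartCompiler`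

Worker start file generated by the line lead: the statement below is BYTE-IDENTICAL to the registered
stub signature (do not edit it; the gate matches name + signature). Replace `sorry` by a proof; add
helper lemmas ABOVE the theorem in this namespace (docstring on every declaration); keep ≤ 400 lines
(generic lemmas belong in a Literature/ file proposed separately and imported here).
-/

noncomputable section

open Set MeasureTheory
open Literature.ModelTheory.ExponentialFields (IsSemialgebraic)
open Literature.NumberTheory.Transcendental
open Literature.NumberTheory.Transcendental.KZ
open Summit.KontsevichZagierPeriods.FurushoPentagon.ReducedPeriodRing (unitCube mem_unitCube)

namespace Summit.KontsevichZagierPeriods.SymplecticScissors.CubeNashNormalFormChartCompiler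

variable {n : ℕ}

/-- Leibniz expansion of the determinant of a continuous linear endomorphism of `ℝⁿ` in the
standard basis: `det L = ∑_σ sign σ ∏ᵢ L(eᵢ)_{σ i}`. [folklore] -/
theorem det_eq_sum_prod (L : (Fin n → ℝ) →L[ℝ] (Fin n → ℝ)) :
    L.det = ∑ σ : Equiv.Perm (Fin n), ((Equiv.Perm.sign σ : ℤ) : ℝ) *
      ∏ i, L (Pi.single i 1) (σ i) := by
  rw [ContinuousLinearMap.det, ← LinearMap.det_toMatrix', Matrix.det_apply']
  simp only [LinearMap.toMatrix'_apply, ContinuousLinearMap.coe_coe]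

/-- The Jacobian determinant `x ↦ det (fderiv ℝ Φ x)` of a map analytic at `p` is analytic at `p`
(the derivative is analytic, and the determinant is a polynomial in its entries). [folklore] -/
theorem analyticAt_det_fderiv {Φ : (Fin n → ℝ) → (Fin n → ℝ)} {p : Fin n → ℝ}
    (h : AnalyticAt ℝ Φ p) : AnalyticAt ℝ (fun x => (fderiv ℝ Φ x).det) p := by
  have hD : AnalyticAt ℝ (fderiv ℝ Φ) p := h.fderiv
  simp_rw [det_eq_sum_prod]
  refine Finset.analyticAt_fun_sum _ fun σ _ => analyticAt_const.mul
    (Finset.analyticAt_fun_prod _ fun i _ => ?_)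
  have hT := ((ContinuousLinearMap.proj (R := ℝ) (φ := fun _ : Fin n => ℝ) (σ i)).comp
    (ContinuousLinearMap.apply ℝ (Fin n → ℝ) (Pi.single i 1))).analyticAt (fderiv ℝ Φ p)
  exact hT.comp hD

/-- A continuous real function without zeros on a preconnected set is either everywhere positive
or everywhere negative there (intermediate value theorem). [folklore] -/
theorem forall_pos_or_forall_neg {X : Type*} [TopologicalSpace X] {S : Set X}
    (hS : IsPreconnected S) {f : X → ℝ} (hf : ContinuousOn f S) (h0 : ∀ x ∈ S, f x ≠ 0) :
    (∀ x ∈ S, 0 < f x) ∨ (∀ x ∈ S, f x < 0) := by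
  by_contra h
  push Not at h
  obtain ⟨⟨x, hx, hfx⟩, ⟨y, hy, hfy⟩⟩ := h
  obtain ⟨z, hz, hfz⟩ := hS.intermediate_value hx hy hf ⟨hfx, hfy⟩
  exact h0 z hz hfz

/-- A function continuous on the closed unit cube and `ℚ`-semialgebraic on the open unit cube is
`ℚ`-semialgebraic on the closed cube: its graph over the closed cube is the closure of its graph
over the open cube, and closures of semialgebraic sets are semialgebraic. [folklore] -/
theorem isSemialgebraicFunOn_piIcc_of_piIoo {g : (Fin n → ℝ) → ℝ}
    (hgc : ContinuousOn g (Set.pi Set.univ fun _ : Fin n => Set.Icc (0:ℝ) 1))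
    (hgs : IsSemialgebraicFunOn ℚ (Set.pi Set.univ fun _ : Fin n => Set.Ioo (0:ℝ) 1) g) :
    IsSemialgebraicFunOn ℚ (Set.pi Set.univ fun _ : Fin n => Set.Icc (0:ℝ) 1) g := by
  set C : Set (Fin n → ℝ) := Set.pi Set.univ fun _ : Fin n => Set.Icc (0:ℝ) 1 with hC
  set O : Set (Fin n → ℝ) := Set.pi Set.univ fun _ : Fin n => Set.Ioo (0:ℝ) 1 with hO
  set G : (Fin n → ℝ) → (Fin (n + 1) → ℝ) := fun x => Fin.snoc x (g x) with hG
  have hGc : ContinuousOn G C :=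
    ContinuousOn.finSnoc (X := fun _ : Fin (n + 1) => ℝ) continuousOn_id hgc
  have hOC : O ⊆ C := Set.pi_mono fun _ _ => Ioo_subset_Icc_self
  have hclO : closure O = C := by
    rw [hO, closure_pi_set]
    simp [closure_Ioo (zero_ne_one : (0:ℝ) ≠ 1), hC]
  have himg : ∀ S : Set (Fin n → ℝ),
      {z : Fin (n + 1) → ℝ | ∃ x ∈ S, z = Fin.snoc x (g x)} = G '' S := by
    intro S
    ext z
    simp only [mem_setOf_eq, mem_image, hG]
    constructor
    · rintro ⟨x, hx, rfl⟩
      exact ⟨x, hx, rfl⟩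
    · rintro ⟨x, hx, rfl⟩
      exact ⟨x, hx, rfl⟩
  have hGc' : ContinuousOn G (closure O) := by rw [hclO]; exact hGc
  have h1 : G '' closure O ⊆ closure (G '' O) := hGc'.image_closure
  rw [hclO] at h1
  have h2 : closure (G '' O) ⊆ G '' C :=
    closure_minimal (image_mono hOC)
      ((isCompact_univ_pi fun _ => isCompact_Icc).image_of_continuousOn hGc).isClosed
  have hEq : G '' C = closure (G '' O) := h1.antisymm h2
  show IsSemialgebraic ℚ {z : Fin (n + 1) → ℝ | ∃ x ∈ C, z = Fin.snoc x (g x)}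
  rw [himg C, hEq, ← himg O]
  exact Literature.ModelTheory.ExponentialFields.isSemialgebraic_closure hgs

/-- On an open `ℚ`-semialgebraic set, the Jacobian determinant of a `ℚ`-semialgebraic map which is
differentiable at every point is a `ℚ`-semialgebraic function: the partial derivatives of its
(semialgebraic) coordinate functions are semialgebraic, and the determinant is a polynomial in
them. [cite: BasuPollackRoy2006, Prop. 3.22] -/
theorem isSemialgebraicFunOn_det_fderiv {W : Set (Fin n → ℝ)} {Φ : (Fin n → ℝ) → (Fin n → ℝ)}
    (hW : IsOpen W) (hWs : IsSemialgebraic ℚ W) (hΦ : IsSemialgebraicMapOn ℚ W Φ)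
    (hd : ∀ x ∈ W, DifferentiableAt ℝ Φ x) :
    IsSemialgebraicFunOn ℚ W fun x => (fderiv ℝ Φ x).det := by
  have hcoord : ∀ j, IsSemialgebraicFunOn ℚ W fun x => Φ x j :=
    (isSemialgebraicMapOn_iff_forall_holds hWs).1 hΦ
  have hdj : ∀ j, ∀ x ∈ W, DifferentiableAt ℝ (fun x => Φ x j) x := fun j x hx =>
    differentiableAt_pi.1 (hd x hx) j
  have hpart : ∀ j k, IsSemialgebraicFunOn ℚ W fun x =>
      fderiv ℝ (fun x => Φ x j) x (Pi.single k 1) :=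
    fun j k => (hcoord j).fderiv_apply_single hW (hdj j) k
  have hentry : ∀ j k, IsSemialgebraicFunOn ℚ W fun x => fderiv ℝ Φ x (Pi.single k 1) j := by
    intro j k
    refine (hpart j k).congr fun x hx => ?_
    simp only [fderiv_apply (hd x hx) j, ContinuousLinearMap.coe_comp, Function.comp_apply,
      ContinuousLinearMap.proj_apply]
  have hM := IsSemialgebraicFunOn.matrix_det hWs
    (M := fun x => LinearMap.toMatrix' ((fderiv ℝ Φ x : (Fin n → ℝ) →L[ℝ] (Fin n → ℝ)) :
      (Fin n → ℝ) →ₗ[ℝ] (Fin n → ℝ))) fun i j => by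
      simpa only [LinearMap.toMatrix'_apply, ContinuousLinearMap.coe_coe] using hentry i j
  refine hM.congr fun x _ => ?_
  simp only [LinearMap.det_toMatrix']

/-- The closed unit cube minus the open unit cube is Lebesgue-null. [folklore] -/
theorem volume_piIcc_diff_piIoo :
    volume ((Set.pi Set.univ fun _ : Fin n => Set.Icc (0:ℝ) 1) \
      Set.pi Set.univ fun _ : Fin n => Set.Ioo (0:ℝ) 1) = 0 := by
  have h : (Set.pi Set.univ fun _ : Fin n => Set.Ioo (0:ℝ) 1) =ᵐ[volume]
      (Set.pi Set.univ fun _ : Fin n => Set.Icc (0:ℝ) 1) :=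
    Measure.pi_Ioo_ae_eq_pi_Icc (f := fun _ : Fin n => (0:ℝ)) (g := fun _ => (1:ℝ))
  exact (ae_eq_set.1 h).2

/-- The open unit cube `Set.pi univ (fun _ => Ioo 0 1)` is the `openUnitCube` of `NashCubes.lean`.
[folklore] -/
theorem piIoo_eq_openUnitCube :
    (Set.pi Set.univ fun _ : Fin n => Set.Ioo (0:ℝ) 1) = openUnitCube n := by
  ext x
  simp only [mem_univ_pi, mem_openUnitCube_iff]

/-- The closed unit cube `Set.pi univ (fun _ => Icc 0 1)` is `ReducedPeriodRing.unitCube`.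
[folklore] -/
theorem piIcc_eq_unitCube :
    (Set.pi Set.univ fun _ : Fin n => Set.Icc (0:ℝ) 1) = unitCube n := by
  ext x
  simp only [mem_univ_pi, mem_Icc, mem_unitCube]

/-- **One chart, given the tame Jacobian.** For an integrand-`1` representation `K`, a chart `Φ`
(analytic at the closed cube, `ℚ`-semialgebraic and injective on the open cube `O`, `Φ '' O` inside
`K.domain`) and a function `g` analytic at the closed cube, `ℚ`-semialgebraic on `O` and equal to
`|det DΦ|` there: `[Φ '' O, K.integrand] ≡ [[0,1]ⁿ, g]` modulo `KZ.relations` — one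
change-of-variables move `[O, g] − [Φ '' O, 1]` and the null boundary `[0,1]ⁿ ∖ O`.
[cite: KontsevichZagier2001, §1.2 rules (1), (2)] -/
theorem chart_core (K : IntegralRep n) (hK1 : ∀ x ∈ K.domain, K.integrand x = 1)
    (Φ : (Fin n → ℝ) → (Fin n → ℝ))
    (hΦa : AnalyticOnNhd ℝ Φ (Set.pi Set.univ fun _ : Fin n => Set.Icc (0:ℝ) 1))
    (hΦs : IsSemialgebraicMapOn ℚ (Set.pi Set.univ fun _ : Fin n => Set.Ioo (0:ℝ) 1) Φ)
    (hΦi : InjOn Φ (Set.pi Set.univ fun _ : Fin n => Set.Ioo (0:ℝ) 1))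
    (hsub : Φ '' Set.pi Set.univ (fun _ : Fin n => Set.Ioo (0:ℝ) 1) ⊆ K.domain)
    (g : (Fin n → ℝ) → ℝ)
    (hga : AnalyticOnNhd ℝ g (Set.pi Set.univ fun _ : Fin n => Set.Icc (0:ℝ) 1))
    (hgs : IsSemialgebraicFunOn ℚ (Set.pi Set.univ fun _ : Fin n => Set.Ioo (0:ℝ) 1) g)
    (hgJ : ∀ x ∈ Set.pi Set.univ (fun _ : Fin n => Set.Ioo (0:ℝ) 1),
      g x = |(fderiv ℝ Φ x).det|) :
    ∃ (R t : IntegralRep n), R.domain = Φ '' Set.pi Set.univ (fun _ : Fin n => Set.Ioo (0:ℝ) 1) ∧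
      R.integrand = K.integrand ∧ t.domain = unitCube n ∧ AnalyticOnNhd ℝ t.integrand (unitCube n) ∧
      of R - of t ∈ relations := by
  set C : Set (Fin n → ℝ) := Set.pi Set.univ fun _ : Fin n => Set.Icc (0:ℝ) 1 with hC
  set O : Set (Fin n → ℝ) := Set.pi Set.univ fun _ : Fin n => Set.Ioo (0:ℝ) 1 with hO
  have hOC : O ⊆ C := Set.pi_mono fun _ _ => Ioo_subset_Icc_self
  have hCU : C = unitCube n := piIcc_eq_unitCube
  have hOs : IsSemialgebraic ℚ O := by
    rw [hO, piIoo_eq_openUnitCube]; exact isSemialgebraic_openUnitCube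
  have hCs : IsSemialgebraic ℚ C := by rw [hCU]; exact isSemialgebraic_cube
  have hIm : IsSemialgebraic ℚ (Φ '' O) :=
    IsSemialgebraicMapOn.isSemialgebraic_image_holds hΦs Subset.rfl hOs
  have hgc : ContinuousOn g C := fun x hx => (hga x hx).continuousAt.continuousWithinAt
  have hgC : IsSemialgebraicFunOn ℚ C g := isSemialgebraicFunOn_piIcc_of_piIoo hgc hgs
  -- the tame cube `t = [[0,1]ⁿ, g]`, its restriction `r = [O, g]`, and `R = [Φ '' O, 1]`
  let t : IntegralRep n :=
    { domain := C
      integrand := g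
      isSemialgebraic_domain := hCs
      isSemialgebraicFunOn_integrand := hgC
      integrableOn := hgc.integrableOn_compact (isCompact_univ_pi fun _ => isCompact_Icc) }
  let r : IntegralRep n := t.restrict O hOs hOC
  let R : IntegralRep n := K.restrict (Φ '' O) hIm hsub
  have htr : of t - of r ∈ relations :=
    t.of_sub_of_restrict_mem_relations hOs hOC volume_piIcc_diff_piIoo
  have hcov : of r - of R ∈ changeOfVariablesRel := by
    refine ⟨n, r, R, Φ, fun x => fderiv ℝ Φ x, hΦs, fun x hx => ?_, hΦi, rfl, fun x hx => ?_, rfl⟩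
    · exact (hΦa x (hOC hx)).differentiableAt.hasFDerivAt.hasFDerivWithinAt
    · show g x = K.integrand (Φ x) * |(fderiv ℝ Φ x).det|
      rw [hK1 _ (hsub (mem_image_of_mem Φ hx)), one_mul, hgJ x hx]
  refine ⟨R, t, rfl, rfl, hCU, fun p hp => hga p (hCU ▸ hp : p ∈ C), ?_⟩
  have : of R - of t = -((of r - of R) + (of t - of r)) := by abel
  rw [this]
  exact relations.neg_mem (relations.add_mem (changeOfVariablesRel_subset_relations hcov) htr)

/-- **One chart.** As `chart_core`, for a chart with non-vanishing Jacobian on the open cube: the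
sign of `det DΦ` is constant on the (connected) open cube, so `g = ±det DΦ` is analytic at the
closed cube (`AnalyticAt.fderiv`), `ℚ`-semialgebraic on the open cube (derivatives of semialgebraic
functions are semialgebraic) and equals `|det DΦ|` there.
[cite: KontsevichZagier2001, §1.2 rules (1), (2)] -/
theorem chart (K : IntegralRep n) (hK1 : ∀ x ∈ K.domain, K.integrand x = 1)
    (Φ : (Fin n → ℝ) → (Fin n → ℝ))
    (hΦa : AnalyticOnNhd ℝ Φ (Set.pi Set.univ fun _ : Fin n => Set.Icc (0:ℝ) 1))
    (hΦs : IsSemialgebraicMapOn ℚ (Set.pi Set.univ fun _ : Fin n => Set.Ioo (0:ℝ) 1) Φ)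
    (hΦi : InjOn Φ (Set.pi Set.univ fun _ : Fin n => Set.Ioo (0:ℝ) 1))
    (hdet : ∀ x ∈ Set.pi Set.univ (fun _ : Fin n => Set.Ioo (0:ℝ) 1), (fderiv ℝ Φ x).det ≠ 0)
    (hsub : Φ '' Set.pi Set.univ (fun _ : Fin n => Set.Ioo (0:ℝ) 1) ⊆ K.domain) :
    ∃ (R t : IntegralRep n), R.domain = Φ '' Set.pi Set.univ (fun _ : Fin n => Set.Ioo (0:ℝ) 1) ∧
      R.integrand = K.integrand ∧ t.domain = unitCube n ∧ AnalyticOnNhd ℝ t.integrand (unitCube n) ∧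
      of R - of t ∈ relations := by
  set C : Set (Fin n → ℝ) := Set.pi Set.univ fun _ : Fin n => Set.Icc (0:ℝ) 1 with hC
  set O : Set (Fin n → ℝ) := Set.pi Set.univ fun _ : Fin n => Set.Ioo (0:ℝ) 1 with hO
  have hOC : O ⊆ C := Set.pi_mono fun _ _ => Ioo_subset_Icc_self
  have hOs : IsSemialgebraic ℚ O := by
    rw [hO, piIoo_eq_openUnitCube]; exact isSemialgebraic_openUnitCube
  have hOo : IsOpen O := isOpen_set_pi finite_univ fun _ _ => isOpen_Ioo
  have hJa : AnalyticOnNhd ℝ (fun x => (fderiv ℝ Φ x).det) C := fun p hp =>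
    analyticAt_det_fderiv (hΦa p hp)
  have hJs : IsSemialgebraicFunOn ℚ O (fun x => (fderiv ℝ Φ x).det) :=
    isSemialgebraicFunOn_det_fderiv hOo hOs hΦs fun x hx => (hΦa x (hOC hx)).differentiableAt
  have hJc : ContinuousOn (fun x => (fderiv ℝ Φ x).det) O := fun x hx =>
    (hJa x (hOC hx)).continuousAt.continuousWithinAt
  have hOconn : IsPreconnected O := (convex_pi fun _ _ => convex_Ioo (0:ℝ) 1).isPreconnected
  rcases forall_pos_or_forall_neg hOconn hJc hdet with hpos | hneg
  · exact chart_core K hK1 Φ hΦa hΦs hΦi hsub (fun x => (fderiv ℝ Φ x).det) hJa hJs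
      fun x hx => (abs_of_pos (hpos x hx)).symm
  · exact chart_core K hK1 Φ hΦa hΦs hΦi hsub (fun x => -(fderiv ℝ Φ x).det)
      (fun p hp => (hJa p hp).neg) hJs.fun_neg fun x hx => (abs_of_neg (hneg x hx)).symm

/-- **Stub S1 `stub_chartCompiler` (the chart compiler; provable now, M).** A FORMAT atlas of the
domain of an integrand-`1` representation `K` (charts analytic at the closed cube, `ℚ`-semialgebraic,
injective and with non-vanishing Jacobian on the open cube; open-cube images inside `K.domain`,
pairwise disjoint, exhausting it up to a null set) puts `[K]`, modulo `KZ.relations`, in the span of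
the tame cube classes: per chart one change-of-variables move `[(0,1)ⁿ, |det DΦᵢ|] − [Φᵢ '' (0,1)ⁿ, 1]`
(`|det DΦᵢ| = ±det DΦᵢ` is analytic near the closed cube and `ℚ`-semialgebraic on it), domain
additivity over the disjoint cover and the null remainder, and `(0,1)ⁿ → [0,1]ⁿ` across the null
boundary. [Kontsevich–Zagier 2001, §1.2 rules (1), (2); Ayoub 2014, Rem. 12] -/
theorem stub_chartCompiler : ∀ (n : ℕ) (K : IntegralRep n), (∀ x ∈ K.domain, K.integrand x = 1) → ∀ (N : ℕ) (Φ : Fin N → (Fin n → ℝ) → (Fin n → ℝ)), (∀ i, (AnalyticOnNhd ℝ (Φ i) (Set.pi Set.univ (fun _ : Fin n => Set.Icc (0:ℝ) 1)) ∧ IsSemialgebraicMapOn ℚ (Set.pi Set.univ (fun _ : Fin n => Set.Ioo (0:ℝ) 1)) (Φ i) ∧ Set.InjOn (Φ i) (Set.pi Set.univ (fun _ : Fin n => Set.Ioo (0:ℝ) 1)) ∧ ∀ x ∈ Set.pi Set.univ (fun _ : Fin n => Set.Ioo (0:ℝ) 1), (fderiv ℝ (Φ i) x).det ≠ 0)) →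 (∀ i, Φ i '' Set.pi Set.univ (fun _ : Fin n => Set.Ioo (0:ℝ) 1) ⊆ K.domain) → Pairwise (fun i i' => Disjoint (Φ i '' Set.pi Set.univ (fun _ : Fin n => Set.Ioo (0:ℝ) 1)) (Φ i' '' Set.pi Set.univ (fun _ : Fin n => Set.Ioo (0:ℝ) 1))) → MeasureTheory.volume (K.domain \ ⋃ i, Φ i '' Set.pi Set.univ (fun _ : Fin n => Set.Ioo (0:ℝ) 1)) = 0 → ∃ c ∈ Summit.KontsevichZagierPeriods.FurushoPentagon.ReducedPeriodRing.cubicalSpan, of K - c ∈ relations := by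
  intro n K hK1 N Φ hΦ hsub hdisj hnull
  choose R t hRd hRi htd hta hRt using fun i =>
    chart K hK1 (Φ i) (hΦ i).1 (hΦ i).2.1 (hΦ i).2.2.1 (hΦ i).2.2.2 (hsub i)
  refine ⟨∑ i, of (t i),
    sum_mem fun i _ => AddSubgroup.subset_closure ⟨n, t i, htd i, hta i, rfl⟩, ?_⟩
  have hKR : of K - ∑ i, of (R i) ∈ relations := by
    refine of_sub_sum_of_mem_relations Finset.univ K R (fun i _ => ?_) (fun i _ => ?_) ?_ ?_
    · rw [hRd i, Set.sdiff_eq_empty.2 (hsub i), measure_empty]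
    · exact fun x _ => congrFun (hRi i) x
    · simpa only [Finset.mem_univ, iUnion_true, hRd] using hnull
    · exact (hdisj.mono @fun i j h => by
        rw [hRd i, hRd j, Set.disjoint_iff_inter_eq_empty.1 h, measure_empty]).set_pairwise _
  have : of K - ∑ i, of (t i) = (of K - ∑ i, of (R i)) + ∑ i, (of (R i) - of (t i)) := by
    rw [Finset.sum_sub_distrib]; abel
  rw [this]
  exact relations.add_mem hKR (sum_mem fun i _ => hRt i)

end Summit.KontsevichZagierPeriods.SymplecticScissors.CubeNashNormalFormChartCompiler

end
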